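import Summits.CriticalPhenomena.PercolationContinuityZ3.Theorems.PercNearOneGluingNoHeavyQuantFarSunLawDefs
import Mathlib.Algebra.BigOperators.Ring.Finset
import Mathlib.Algebra.Order.BigOperators.Group.Finset
import Mathlib.Data.Real.Basic
import Mathlib.Data.Nat.Cast.Field
import Mathlib.Tactic.FieldSimp
import Mathlib.Tactic.Ring
import Mathlib.Tactic.Linarith
import Mathlib.Tactic.Positivity
import HarnessLib

/-!
# FAR beyond trees: the FLANK AUTOMATON and the DELAY-2 BUDGET GAME — a kernel-checkable lower bound for pattern expectations
# over all words of a given weight (definitions + soundness)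

builds on p205010 (kernel theorem, internal audit signed; external expert review pending)

Support file (`--supports stmt-CriticalPhenomena-4575`), seat `prim-cert-1` (gen 39); memo `prim-cert-1/FROM-prim-cert-1-g39-VERTEX-GAME.md` §3, §4 (L3).

* **The flank automaton** (`HairyCycle.FSt`, `FSt.op`, `FSt.cl`, `FSt.pay`): reading the open/closed word of the hairs left to right it maintains
  `A` = #open so far, `Nc` = #closed at the current level, `Np` = #closed at the previous level, `Cf` = #closed hairs already known to have ≥ 2 open
  hairs on each side ("confirmed flanked"), with caps `Amax, C, Cc`; its payoff `Cf/(A−3)·𝟙[A ≥ 4] − 𝟙[A ≤ 4]` (credit `1/(Kcred−3)` once `A = Amax`) is, cap for cap,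
  at most the layer-2 flank payoff `Fl/(T−3)·𝟙[T≥4] − 𝟙[T≤4]` whose mean is `G_avg − 1` (the comparison with `witGavg` is a separate file).
* **`HairyCycle.autoE`** — the mean payoff when hair `t` is open with probability `p_t` (a list of reals), by the obvious recursion.
* **The delay-2 budget game** (`HairyCycle.GameSpec`, `gameBase`, `gameStep`, `gameTable`, `gameStart`, `gameCert`): letters `i` carry a probability
  `k_i/q` and an integer weight `w_i`; `gameTable P n` tabulates (as integer numerators over `q^(n+2)·Lpay`, `none` = no word) the value of the game in which an
  adversary extends the word letter by letter knowing the outcomes of all but the last two letters, total weight prescribed.  An oblivious word is one strategy, so: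
* SOUNDNESS (companion file `…QuantFarSunGameSound`: `GameSpec.gameLayer_sound`, `GameSpec.autoE_nonneg_of_gameCert`): if `gameCert P NB K Bs = true`
  then `0 ≤ autoE (word)` for EVERY word of length `K` over the alphabet whose weight lies in `Bs` (and is `≤ NB`).  Checked instances (`native_decide`)
  live in the certificate files; e.g. `⟨8,4,6,12,3,36,[(1,0),(3,1)]⟩.gameCert 12 12 (List.range 13) = true` (K = 12, letters {1/3, 1}: 20 s).
Definitions only (plus the evaluation structure); elementary [this work]; no sorries; standard axioms.
-/

namespace Summit.CriticalPhenomena.PercolationContinuityZ3.Theorems.HairyCycle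

open Finset

/-! ## The flank automaton -/

/-- State of the flank automaton: `A` opens so far, `Nc` closed at the current level, `Np` closed at the previous level, `Cf` confirmed flanked closed
hairs (all capped). [this work] -/
structure FSt where
  /-- number of open hairs read so far (capped at `Amax`) -/
  A : ℕ
  /-- closed hairs read at the current level (capped at `C`) -/
  Nc : ℕ
  /-- closed hairs read at the previous level (capped at `C`) -/
  Np : ℕ
  /-- closed hairs confirmed to have two open hairs on each side (capped at `Cc`) -/
  Cf : ℕ
deriving DecidableEq

namespace FSt

/-- Reading a CLOSED hair. [this work] -/
def cl (C : ℕ) (s : FSt) : FSt := ⟨s.A, min (s.Nc + 1) C, s.Np, s.Cf⟩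

/-- Reading an OPEN hair: the closed hairs of the previous level now have two opens after them, and are confirmed if that level is `≥ 2`
(i.e. `A ≥ 3`). [this work] -/
def op (Amax Cc : ℕ) (s : FSt) : FSt :=
  ⟨min (s.A + 1) Amax, 0, s.Nc, min (s.Cf + (if 3 ≤ s.A then s.Np else 0)) Cc⟩

/-- The payoff `Cf/(A−3)·𝟙[4 ≤ A] − 𝟙[A ≤ 4]`, with the conservative credit `1/(Kcred−3)` at the cap `A = Amax`. [this work] -/
noncomputable def pay (Amax Kcred : ℕ) (s : FSt) : ℝ :=
  (if 4 ≤ s.A then (s.Cf : ℝ) / (if s.A < Amax then ((s.A : ℝ) - 3) else ((Kcred : ℝ) - 3)) else 0) - (if s.A ≤ 4 then 1 else 0)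

/-- Integer numerator of the payoff over a common multiple `L` of the denominators. [this work] -/
def payNum (Amax Kcred L : ℕ) (s : FSt) : ℤ :=
  (if 4 ≤ s.A then ((s.Cf * (if s.A < Amax then L / (s.A - 3) else L / (Kcred - 3)) : ℕ) : ℤ) else 0) - (if s.A ≤ 4 then (L : ℤ) else 0)

/-- The start state. [this work] -/
def start : FSt := ⟨0, 0, 0, 0⟩

/-- A state respects the caps. [this work] -/
def Valid (Amax C Cc : ℕ) (s : FSt) : Prop :=
  s.A ≤ Amax ∧ s.Nc ≤ C ∧ s.Np ≤ C ∧ s.Cf ≤ Cc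

end FSt

/-- **Mean payoff of the flank automaton** started at `s` when the remaining hairs are open with probabilities `p₀, p₁, …` (independently). [this work] -/
noncomputable def autoE (Amax C Cc Kcred : ℕ) : FSt → List ℝ → ℝ
  | s, [] => s.pay Amax Kcred
  | s, p :: ps => p * autoE Amax C Cc Kcred (s.op Amax Cc) ps + (1 - p) * autoE Amax C Cc Kcred (s.cl C) ps

/-! ## The delay-2 budget game -/

/-- Parameters of a game: automaton caps, credit index, probability denominator `q`, payoff common multiple `Lpay`, and the alphabet as a list of
(numerator `k`, weight `w`) — letter `i` is a hair open with probability `k_i/q` contributing `w_i` to the budget. [this work] -/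
structure GameSpec where
  /-- cap on the open count -/
  Amax : ℕ
  /-- cap on the per-level closed counts -/
  C : ℕ
  /-- cap on the confirmed count -/
  Cc : ℕ
  /-- credit index: at `A = Amax` the payoff credits `1/(Kcred−3)` -/
  Kcred : ℕ
  /-- common denominator of the letter probabilities -/
  q : ℕ
  /-- common multiple of the payoff denominators `1, …, Amax−4` and `Kcred−3` -/
  Lpay : ℕ
  /-- the alphabet: (probability numerator, weight) -/
  letters : List (ℕ × ℕ)

namespace GameSpec

variable (P : GameSpec)

/-- Number of letters. -/
def nL : ℕ := P.letters.length
/-- Probability numerator of letter `i` (junk `0` out of range). -/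
def kOf (i : ℕ) : ℕ := (P.letters.getD i (0, 0)).1
/-- Weight of letter `i` (junk `0` out of range). -/
def wOf (i : ℕ) : ℕ := (P.letters.getD i (0, 0)).2
/-- Probability of letter `i` as a real. -/
noncomputable def gOf (i : ℕ) : ℝ := (P.kOf i : ℝ) / (P.q : ℝ)
/-- Number of automaton states. -/
def nS : ℕ := (P.Amax + 1) * (P.C + 1) * (P.C + 1) * (P.Cc + 1)
/-- Index of a state. -/
def sIdx (s : FSt) : ℕ := s.Cf + (s.Np + (s.Nc + s.A * (P.C + 1)) * (P.C + 1)) * (P.Cc + 1)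
/-- Flat index of (state, pending letters `a`, `b`, budget `B`) for budgets `≤ NB`. -/
def eIdx (NB : ℕ) (s : FSt) (a b B : ℕ) : ℕ := B + (b + (a + P.sIdx s * P.nL) * P.nL) * (NB + 1)

/-- `min` on `Option ℤ` with `none` read as `+∞` (no word). -/
def omin : Option ℤ → Option ℤ → Option ℤ
  | none, y => y
  | x, none => x
  | some x, some y => some (min x y)

/-- Base layer (no letter left to commit, two pending letters `a`, `b`): the exact numerator over `q²·Lpay` of the mean payoff, at budget `0`;
`none` at positive budget. [this work] -/
def baseVal (s : FSt) (a b B : ℕ) : Option ℤ :=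
  if B = 0 then
    some (let ka : ℤ := P.kOf a; let kb : ℤ := P.kOf b; let qq : ℤ := P.q
      let so := s.op P.Amax P.Cc; let sc := s.cl P.C
      ka * (kb * (so.op P.Amax P.Cc).payNum P.Amax P.Kcred P.Lpay + (qq - kb) * (so.cl P.C).payNum P.Amax P.Kcred P.Lpay) +
        (qq - ka) * (kb * (sc.op P.Amax P.Cc).payNum P.Amax P.Kcred P.Lpay + (qq - kb) * (sc.cl P.C).payNum P.Amax P.Kcred P.Lpay))
  else none

/-- One Bellman step: from the layer-`n` lookup `prev` to the value at (state `s`, pending `a`, `b`, budget `B`) with `n+1` letters to commit: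
`min_i [k_a·prev(op s, b, i, B − w_i) + (q − k_a)·prev(cl s, b, i, B − w_i)]` over letters `i` with `w_i ≤ B`. [this work] -/
def stepVal (prev : FSt → ℕ → ℕ → ℕ → Option ℤ) (s : FSt) (a b B : ℕ) : Option ℤ :=
  (List.range P.nL).foldl
    (fun acc i =>
      if P.wOf i ≤ B then
        omin acc
          (match prev (s.op P.Amax P.Cc) b i (B - P.wOf i), prev (s.cl P.C) b i (B - P.wOf i) with
            | some u, some v => some ((P.kOf a : ℤ) * u + ((P.q : ℤ) - P.kOf a) * v)
            | _, _ => none)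
      else acc)
    none

/-- Size of a layer table (budgets `0..NB`). -/
def tSize (NB : ℕ) : ℕ := P.nS * P.nL * P.nL * (NB + 1)

/-- Decode a flat index into (state, pending `a`, `b`, budget). -/
def dIdx (NB i : ℕ) : FSt × ℕ × ℕ × ℕ :=
  let B := i % (NB + 1)
  let r₁ := i / (NB + 1)
  let b := r₁ % P.nL
  let r₂ := r₁ / P.nL
  let a := r₂ % P.nL
  let r₃ := r₂ / P.nL
  let Cf := r₃ % (P.Cc + 1)
  let r₄ := r₃ / (P.Cc + 1)
  let Np := r₄ % (P.C + 1)
  let r₅ := r₄ / (P.C + 1)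
  let Nc := r₅ % (P.C + 1)
  let A := r₅ / (P.C + 1)
  (⟨A, Nc, Np, Cf⟩, a, b, B)

/-- Tabulate a layer function into a flat array (budgets `0..NB`). -/
def tabulate (NB : ℕ) (F : FSt → ℕ → ℕ → ℕ → Option ℤ) : Array (Option ℤ) :=
  Array.ofFn fun i : Fin (P.tSize NB) => let d := P.dIdx NB i.1; F d.1 d.2.1 d.2.2.1 d.2.2.2

/-- In-range test for (state, pending letters, budget). -/
def InRange (NB : ℕ) (s : FSt) (a b B : ℕ) : Prop :=
  s.A ≤ P.Amax ∧ s.Nc ≤ P.C ∧ s.Np ≤ P.C ∧ s.Cf ≤ P.Cc ∧ a < P.nL ∧ b < P.nL ∧ B ≤ NB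

/-- `InRange` is decidable. -/
instance (NB : ℕ) (s : FSt) (a b B : ℕ) : Decidable (P.InRange NB s a b B) := by
  unfold InRange; infer_instance

/-- Read a tabulated layer back as a function (`none` outside the table). -/
def lookup (NB : ℕ) (arr : Array (Option ℤ)) (s : FSt) (a b B : ℕ) : Option ℤ :=
  if P.InRange NB s a b B then (arr[P.eIdx NB s a b B]?).getD none else none

/-- Iterating the Bellman step `n` times on a tabulated layer. [this work] -/
def gameIter (NB : ℕ) : ℕ → Array (Option ℤ) → Array (Option ℤ)
  | 0, acc => acc
  | n + 1, acc => gameIter NB n (P.tabulate NB (P.stepVal (P.lookup NB acc)))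

/-- **The game table**, layer `n` (letters still to commit), as a flat array over (state, pending `a`, `b`, budget `≤ NB`). [this work] -/
def gameArr (NB n : ℕ) : Array (Option ℤ) := P.gameIter NB n (P.tabulate NB P.baseVal)

/-- Layer `n` of the game table read as a function (`none` = no word / outside the table). [this work] -/
def gameLayer (NB n : ℕ) : FSt → ℕ → ℕ → ℕ → Option ℤ := P.lookup NB (P.gameArr NB n)

/-- Start value from a tabulated layer `T` (meant: layer `K−2`) for words of weight `B`: `min_{a,b} T(start, a, b, B − w_a − w_b)`. [this work] -/
def startOf (NB : ℕ) (T : Array (Option ℤ)) (B : ℕ) : Option ℤ :=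
  (List.range P.nL).foldl (fun acc a => (List.range P.nL).foldl (fun acc' b =>
      if P.wOf a + P.wOf b ≤ B then omin acc' (P.lookup NB T FSt.start a b (B - P.wOf a - P.wOf b)) else acc') acc) none

/-- Value at the start for words of length `K ≥ 2` and weight `B`. [this work] -/
def gameStart (NB K B : ℕ) : Option ℤ := P.startOf NB (P.gameArr NB (K - 2)) B

/-- **The certificate check**: every listed budget has a nonnegative game value (or admits no word); the table is computed once. [this work] -/
def gameCert (NB K : ℕ) (Bs : List ℕ) : Bool :=
  let T := P.gameArr NB (K - 2)
  Bs.all fun B => match P.startOf NB T B with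
    | some v => decide (0 ≤ v)
    | none => true

/-- Well-formedness of a game specification (what soundness needs): `q > 0`, letter numerators `≤ q`, `Kcred ≥ 4`, and `Lpay` a common multiple
of `1, …, Amax − 4` and `Kcred − 3`, positive. [this work] -/
structure WF (P : GameSpec) : Prop where
  q_pos : 0 < P.q
  k_le : ∀ i, i < P.nL → P.kOf i ≤ P.q
  Kcred4 : 4 ≤ P.Kcred
  Lpay_pos : 0 < P.Lpay
  dvdA : ∀ d, 1 ≤ d → d + 4 ≤ P.Amax → d ∣ P.Lpay
  dvdK : (P.Kcred - 3) ∣ P.Lpay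

end GameSpec

end Summit.CriticalPhenomena.PercolationContinuityZ3.Theorems.HairyCycle
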